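import Summits.QuantumFields.YangMills.Theses.LangevinControlUV
import Summits.QuantumFields.YangMills.Cruxes.LatticeGapInUVUnits.Disproof
import Summits.QuantumFields.YangMills.Theorems.LatticeGapInUVUnits.Negative.LatticeGapInUVUnitsFalseOfStandardScalingSU
import Summits.QuantumFields.YangMills.Theorems.LatticeGapInUVUnits.Negative.ContinuousRulers
import Summits.QuantumFields.YangMills.Theorems.LatticeGapInUVUnitsC.Negative.ContinuousSlowRulers
import Summits.QuantumFields.YangMills.Theorems.LatticeGapInUVUnitsC.Negative.TendstoLoadBearing

/-!
# Disproof of `LatticeGapInUVUnitsC` — standing adversary work file (cdisprove, cycle 1, 2026-08-16)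

Crux item `stmt-QuantumFields-16206` = `Summit.QuantumFields.YangMills.Theses.LangevinControlUV.LatticeGapInUVUnitsC`
(rank 5, the IMPORTED infrared leg of route `LangevinControlUV` in CONTINUOUS intrinsic units): for every compact
simple `G`, faithful unitary `r` and every CONTINUOUS unit map `a` carrying the two-sided femto two-point package
(`Package r a`), all pairs of gauge-invariant local observables cluster on all large tori at rate `c₁ a(β)`
(`Concl r a`). It is LITERALLY the parent disprover's repair C′ (`cruxC_iff_cruxRepaired : _ ↔ CruxRepaired := Iff.rfl`)
of `LatticeGapInUVUnits` (stmt-9366; standing file `Cruxes/LatticeGapInUVUnits/Disproof.lean`, §0–§11, imported here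
and NOT repeated: anatomy `Package`/`Concl`, scale covariance, junk group, `a → 0` against vacuity, germ, weak-coupling
concentration, uniform-`C` strengthening false, socket, SU(N) instance, continuous rulers).

## Findings of cycle 1 (everything below the docblock is checked and sorry-free)

VERDICT: **no kill; no kill is possible in Lean today, and none is expected on paper.** `¬ crux` needs ONE
`(G, r, a)` with `a` CONTINUOUS, `Package r a` TRUE — two-sided cutoff-uniform bounds on the dimension-8 curvature
two-point function in femto boxes, i.e. the open tier-deciding crux `FemtoCurvatureTwoPointC` — AND `Concl r a` FALSE,
i.e. `ξ(β) a(β)` unbounded. Under C′ the two-sided clause pins every admissible continuous ruler to the physical scale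
up to constants (paper RG check: `Γ(s) ≍ ḡ⁴(s)`; on the level sets `n a(β) = s`, which continuity makes unbounded in
`β`, `log(a/a_phys)` may drift only by the factor `√(C/c)`; landed interval pinning `twoPointPinned_of_continuous`,
`ruler_lt_of_continuous`), so `Concl` at an admissible ruler IS the volume-uniform physical mass gap of that `G` —
the Clay infrared content, believed TRUE. A refutation for some `G` would be the negative answer to the Millennium
problem for that `G`.

LANDED this cycle (`Theorems/LatticeGapInUVUnitsC/Negative/`, all `--supports stmt-QuantumFields-16206`, kernel-checked,
axioms `propext/Classical.choice/Quot.sound`):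
* `ContinuousSlowRulers.lean` — p122655, commit ade7fb22eb64: `exists_continuous_slow_ruler` (pure Mathlib + the tree's
  clamp `OpenCone.ramp`): above ANY obstacle (box thresholds `T L`, bad couplings `S j`) a CONTINUOUS antitone unit map
  `0 < a ≤ 1`, `a → 0`, femto boxes `L a(β) ≤ 1` (`L ≥ 2`) only at `β > T L`, and `a (S j) ≥ 1/(j+1)`.
  **Continuity is no obstruction to arbitrarily slow decay.**
* `TendstoLoadBearing.lean` — p122828, commit 8e7ee317b8ee: `tendsto_wcov_plaqField` (ALL fixed-torus plaquette
  covariances `→ 0`, all ordered direction pairs, via `plaqField_swap`); `shape_tendsto_zero_nhdsGT_of_continuous`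
  (H-free TIGHTNESS new under C′: `Γ(s) → 0` as `s ↓ 0`, a genuine one-sided limit); the crux WITHOUT `a → 0` (inline)
  implies the crux and is FALSE modulo `XiUnbounded (suFund N)` (`latticeGapInUVUnitsC_withoutTendsto_false_of_xiUnbounded`,
  witness `a ≡ 2`).
* `LowerBoundLoadBearing.lean` — p123291: `exists_slow_continuous_ruler_above_covariances` (UNCONDITIONAL: a slow
  continuous ruler lies ABOVE every femto covariance) and `exists_slow_continuous_package_id` (so it carries the UPPER
  half of the package with the vanishing shape `Γ(s) = s`, `β₀ = 0`, plus the lower clause with `c = 0`, i.e. the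
  landed RP theorem `axisPlaquetteCov_nonneg`); the UPPER-ONLY crux
  (lower bound deleted, inline) and the SIGN-ONLY crux (`0 < c` ↦ `0 ≤ c`, inline) both imply the crux and are FALSE
  modulo `XiUnbounded (suFund N)` (`latticeGapInUVUnitsC_upperOnly_false_of_xiUnbounded`,
  `latticeGapInUVUnitsC_signOnly_false_of_xiUnbounded`); `not_forall_continuous_concl_of_xiUnbounded` (no clustering
  law in units `a` holds for ALL continuous rulers — a skeleton `(∀ a continuous, X r a) → crux` with `X → Concl`
  that does not feed the package to `X` has an unsatisfiable hypothesis mod `H`; the v1 sketch's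
  `latticeGapInUVUnitsC_of_ratchet` had exactly this shape, the registered v2 skeleton threads the package ✓).

§1 ANATOMY (proved): `cruxC_iff` (the crux is `∀ G r a, Continuous a → Package r a → Concl r a`),
  `cruxC_iff_cruxRepaired` (`Iff.rfl` with the parent's C′), `cruxC_of_crux` (the typed parent implies it).
§2 LOAD-BEARING HYPOTHESES (which clauses any proof must consume):
  * `Continuous a` — dropping it gives the parent crux, false MODULO `StandardScalingSU` (landed
    `latticeGapInUVUnits_false_of_standardScalingSU`; restated `cruxC_without_continuous_false_of`). `Antitone a` is NO
    substitute: the parent's slow rulers are antitone step maps (`exists_slow_ruler_antitone`).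
  * the LOWER bound `c Γ(n a β) ≤ n⁸ Cov` — dropping it: false MODULO `XiUnbounded (suFund N)` only
    (`cruxC_without_lowerBound_false_of`; the UV input is the PROVED concentration; no `FixedTorusTwoSided` needed).
    "Continuity pins the ruler" is, checkably, "continuity AND two-sidedness".
  * `a → 0` — dropping it: false MODULO `XiUnbounded (suFund N)` (`cruxC_without_tendsto_false_of`, `a ≡ 2`).
  * `0 < c` (STRICT) — with `c = 0` the lower clause is axis POSITIVITY `0 ≤ Cov(P_0^{01}, P_{ne₂}^{01})`, a landed
    RP THEOREM on every torus (`axisPlaquetteCov_nonneg`), so the sign-only crux is false MODULO `XiUnbounded`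
    (`cruxC_signOnly_false_of`): the lower clause must carry SIZE `c Γ(s) > 0`, never sign alone.
  * `0 < c₁` in the conclusion — carries all the content (`conclRate_zero`, parent §1).
§2b POSSIBLY UNNECESSARY (hypothesis mutation, information for provers): the ALL-PAIRS upper clause
  `|Cov(P_x^{ij}, P_y^{i'j'})| dist⁸ ≤ C Γ(dist · a β)` is used by no known line on this item (the ratchet seed reads the
  axis clauses at `n = k, 2k`; ruler rigidity / interval pinning read the axis clauses only) — it pins nothing the axis
  two-sided clause does not already pin and is plausibly droppable for 16206 (it matters for `OSLegsAtWeakCouplingC`);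
  `Γ ≤ 1` is a normalisation (rescale `C`); `0 < ℓ₀` only names the femto window. The content of the hypothesis for
  this item is exactly: `Continuous a`, `a → 0`, and the axis clause TWO-sidedly with `c > 0`.
§3 TIGHTNESS (proved, H-free): `Γ(0⁺) = 0` as a one-sided limit under C′ (`shape_tendsto_zero_nhdsGT_of_continuous`,
  restated `cruxC_shape_vanishes`); parent: only along the range of `a`.
§4 SCALE COVARIANCE SURVIVES C′ (proved): `t • a` is continuous, so `package_smul_iff` / `concl_smul_iff` apply
  verbatim (`cruxC_scale`): `c₁` is not intrinsic; the strengthening `∃ c₁ ∀ a` is equivalent to clustering at ALL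
  rates `K a(β)` for package rulers — not refutable without a lower bound on correlations at `n ≥ 1` (none in the tree).
§5 NATURAL STRENGTHENINGS: uniform constant `∃ C ∀ A B` is FALSE for every non-abelian `G` (parent §7, landed
  `not_uniform_constant_clustering_of_simple`); all-times (`S₁`-free, `n` unbounded at fixed torus) variants: parent's
  `AllTimesConclFalse`. `S₁` constant in `β`, `β₂`-free, rate uniform in `r`: no formal handle (need correlation LOWER
  bounds at `n ≥ 1`, i.e. transfer-matrix spectral theory on the torus — absent).
§6 REGIMES TRIED FOR A KILL, all dead: junk `G` (subsingleton: package unsatisfiable, parent §3; finite/abelian: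
  excluded by `IsSimpleCompactGroup`); junk `r` (`LatticeRep` is faithful unitary by structure; `N = 0` impossible for
  a faithful rep of a non-trivial group — and would kill the package anyway); `a` constant / non-decaying (excluded by
  `Tendsto`); `a` fast (conclusion only weaker, parent `concl_of_eventually_le`); `a` slow continuous (package's LOWER
  bound fails at the level crossings: `ruler_lt_of_continuous`); `a` oscillating continuous (`a/a_phys ∈ [1, M]`:
  package and conclusion both survive, no gain); `Γ` bounded below (impossible, `Γ(0⁺) = 0`); small `β` (irrelevant,
  `β₂` existential); `S = 0`, `n = 0` (absorbed by `C_{AB}`); negative `β` (never reached).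
§7 LINE `amplitude-exhaustion-ratchet`, skeleton v2 `Lines/Sketch.lean` (lead, 2026-08-16 19:32): ratio
  `v(β,k) = Cov_{16k}(P_0,P_{2k e₂})/Cov_{16k}(P_0,P_{k e₂})`; stubs S1 `stub_ratioSeed` (package two-sidedness —
  consumes the LOWER bound's SIZE, consistent with §2), S2 `stub_ratioBound` (`v ≤ 1`, RP monotonicity — LANDED
  `…LatticeGapInUVUnitsCStubRatioBound`), S4 `stub_ratioDichotomy` (grow by `1+δ` over `M` octaves OR Knabe
  `GlobalPoincare` at cell `16·2^M k`, `γ` uniform, for ALL `k` beyond the femto edge). `-- Targets`: none of the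
  three is formally attackable (S1/S2 true; S4 has the package as hypothesis, so `¬S4` needs a certified package —
  the crux's own obstruction). PAPER READING OF S4 for the lead: beyond the femto edge `v` is (up to the mild AF rise
  `2⁻⁸Γ(2s)/Γ(s)`) NON-INCREASING in `k` and `→ 0` like `e^{−m k a}` past the crossover, so the growth branch is idle
  where it matters and S4 reduces to its certificate branch at the FIRST window: `GlobalPoincare` with `β`-uniform `γ`
  at cell `2^{M−1}ℓ₀/a(β)` (physical size `2^{M−1}ℓ₀`) on all large tori. A block heat bath at cell `b` has a
  volume-uniform gap iff `b ≳ ξ(β)` (massless modes of wavelength `≫ b` relax at rate `(b/λ)²`), so S4 ⟺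
  [`∃ M` uniform in `β` with `2^{M−1}ℓ₀ ≳ ξ(β) a(β)`, i.e. `ξ a` BOUNDED = the crux] ∧ [Martinelli–Olivieri: gap at
  cells `≫ ξ` ⇒ uniform block Poincaré]. The "confinement scale is OUTPUT (`2^{MJ}`)" is cosmetic: `M` is S4's `∃`,
  and `J = 1` already fires. Verdict: S4 is the parent's promoted certificate with the cell located one octave beyond
  `ξ`; not weaker than the crux; no small-`M` counterexample is formalisable (needs `¬GlobalPoincare` at sub-`ξ` cells,
  i.e. a LOWER bound on a relaxation time — absent from the tree).

## HANDOFF (for re-arm)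
Landed: p122655, p122828, p123291 (Negative/). Sorried here: nothing. Next regimes on re-arm: (i) if the lead
reshapes S4, re-read whether the certificate branch still sits at a cell tied to `ξ` (any `β`-uniform `M` is the crux);
(ii) a formal `¬GlobalPoincare` at small cells would need a relaxation-time LOWER bound for the block heat bath
(variance of a slow mode) — look for `WilsonBlockHeatBath` spectral lemmas before trying; (iii) the only IR obligation
behind every negative lemma here is `XiUnbounded (suFund N)` (parent's `@[conjecture]`); (iv) strengthenings still
without handle: `∃ c₁ ∀ a` (all-rates), `S₁` constant, `β₂`-free.
-/

namespace Summit.QuantumFields.YangMills.Cruxes.LatticeGapInUVUnitsC.Disproof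

open Filter Topology MeasureTheory
open Literature.MathematicalPhysics.QuantumFieldTheory Literature.MathematicalPhysics.QuantumLattice
open Summit.QuantumFields.YangMills.Theses.LangevinControlUV
open Summit.QuantumFields.YangMills.Cruxes.LatticeGapInUVUnits.Disproof
  (Package PackageWith BoxBounds Concl ConclRate CruxRepaired crux_iff package_smul_iff concl_smul_iff
    cruxRepaired_of_crux)
open Summit.QuantumFields.YangMills.Theorems.LatticeGapInUVUnits.Negative
open Summit.QuantumFields.YangMills.Theorems.LatticeGapInUVUnitsC.Negative

noncomputable section

/-! ## §1 Anatomy -/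

/-- The crux is literally the parent disprover's repair C′. [folklore] -/
theorem cruxC_iff_cruxRepaired : LatticeGapInUVUnitsC ↔ CruxRepaired := Iff.rfl

/-- **The crux uncurried**: `∀ G (compact simple) r a, Continuous a → Package r a → Concl r a`. [folklore] -/
theorem cruxC_iff :
    LatticeGapInUVUnitsC ↔
      ∀ (G : Type) [Group G] [TopologicalSpace G] [IsTopologicalGroup G] [CompactSpace G],
        IsCompactSimpleLieGroup G →
          letI : MeasurableSpace G := borel G
          haveI : BorelSpace G := ⟨rfl⟩
          ∀ (r : LatticeRep G) (a : ℝ → ℝ), Continuous a → Package r a → Concl r a := by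
  constructor
  · intro h G _ _ _ _ hG r a ha hP
    obtain ⟨Γ, β₀, ℓ₀, c, C, hℓ, hc, hpos, hlim, hΓ, hbox⟩ := hP
    exact h G hG r a ha ⟨Γ, β₀, ℓ₀, c, C, hℓ, hc, hpos, hlim, hΓ, fun L _ β h₁ h₂ => hbox L β h₁ h₂⟩
  · intro h G _ _ _ _ hG r a ha hP
    obtain ⟨Γ, β₀, ℓ₀, c, C, hℓ, hc, hpos, hlim, hΓ, hbox⟩ := hP
    exact h G hG r a ha ⟨Γ, β₀, ℓ₀, c, C, hℓ, hc, hpos, hlim, hΓ, fun L _ β h₁ h₂ => hbox L β h₁ h₂⟩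

/-- The typed parent (`∀ a`) implies the repaired crux (`∀ a continuous`). [folklore] -/
theorem cruxC_of_crux (h : LatticeGapInUVUnits) : LatticeGapInUVUnitsC :=
  cruxC_iff_cruxRepaired.2 (cruxRepaired_of_crux h)

/-! ## §2 Load-bearing hypotheses — the landed negative lemmas (names for the reader; `LowerBoundLoadBearing` is
landed, p123291, and will be imported here once its farm olean exists — this interim copy omits only that import)

* WITHOUT `Continuous a` (= the typed parent): `latticeGapInUVUnits_false_of_standardScalingSU` (mod `StandardScalingSU`).
* WITHOUT the LOWER bound: `latticeGapInUVUnitsC_upperOnly_false_of_xiUnbounded` (mod `XiUnbounded (suFund N)`).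
* `0 < c` ↦ `0 ≤ c`: `latticeGapInUVUnitsC_signOnly_false_of_xiUnbounded` (mod `XiUnbounded (suFund N)`).
* WITHOUT `a → 0`: `latticeGapInUVUnitsC_withoutTendsto_false_of_xiUnbounded` (mod `XiUnbounded (suFund N)`).
* no clustering law for ALL continuous rulers: `not_forall_continuous_concl_of_xiUnbounded`.
-/

/-- WITHOUT `Continuous a` the crux is the typed parent, false modulo `StandardScalingSU` (landed). [folklore] -/
theorem cruxC_without_continuous_false_of (h : StandardScalingSU) : ¬ LatticeGapInUVUnits :=
  latticeGapInUVUnits_false_of_standardScalingSU h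

example := @latticeGapInUVUnitsC_withoutTendsto_false_of_xiUnbounded
example := @shape_tendsto_zero_nhdsGT_of_continuous

/-! ## §3 Tightness under C′: the shape function vanishes at `0⁺` -/

section Tight

variable {G : Type} [Group G] [TopologicalSpace G] [IsTopologicalGroup G] [CompactSpace G]
  [MeasurableSpace G] [BorelSpace G]

/-- **Every continuous package has `Γ(0⁺) = 0`** (one-sided limit; the parent only had `Γ(a β) → 0`). [folklore] -/
theorem cruxC_shape_vanishes (r : LatticeRep G) {a Γ : ℝ → ℝ} {β₀ ℓ₀ c C : ℝ} (ha : Continuous a)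
    (hP : PackageWith r a Γ β₀ ℓ₀ c C) : Tendsto Γ (𝓝[>] 0) (𝓝 0) := by
  obtain ⟨hℓ, hc, hpos, hlim, hΓ, hbox⟩ := hP
  haveI : NeZero (8 : ℕ) := ⟨by norm_num⟩
  refine shape_tendsto_zero_nhdsGT_of_continuous r hc hℓ ha hpos hlim (fun s hs hsℓ => (hΓ s hs hsℓ).1.le)
    (β₀ := β₀) fun β hβ h8 => ?_
  have hL : ((8 : ℕ) : ℝ) * a β ≤ ℓ₀ := by push_cast; exact h8
  obtain ⟨hax, -⟩ := hbox 8 β hβ hL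
  obtain ⟨h, -⟩ := hax 1 le_rfl (by norm_num)
  have h' : c * Γ (((1 : ℕ) : ℝ) * a β) ≤ ((1 : ℕ) : ℝ) ^ 8 * axisCov r 8 β 1 := h
  simpa using h'

end Tight

/-! ## §4 Scale covariance survives the repair -/

section Scale

variable {G : Type} [Group G] [TopologicalSpace G] [IsTopologicalGroup G] [CompactSpace G]
  [MeasurableSpace G] [BorelSpace G]

/-- `a ↦ t · a` (`t > 0`) preserves continuity, the package and the conclusion: the rate constant `c₁` is not
intrinsic under C′ either. [folklore] -/
theorem cruxC_scale (r : LatticeRep G) (a : ℝ → ℝ) {t : ℝ} (ht : 0 < t) :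
    (Continuous a ↔ Continuous fun β => t * a β) ∧ (Package r a ↔ Package r fun β => t * a β) ∧
      (Concl r a ↔ Concl r fun β => t * a β) := by
  refine ⟨⟨fun h => continuous_const.mul h, fun h => ?_⟩, (package_smul_iff r a ht).symm, (concl_smul_iff r a ht).symm⟩
  have : a = fun β => t⁻¹ * (t * a β) := funext fun β => by field_simp
  rw [this]
  exact continuous_const.mul h

end Scale

end

end Summit.QuantumFields.YangMills.Cruxes.LatticeGapInUVUnitsC.Disproof
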